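import Summits.KontsevichZagierPeriods.KontsevichZagierPeriods.Theorems.LogPrimitiveNL.Negative.LoadBearing
import Summits.KontsevichZagierPeriods.KontsevichZagierPeriods.Theorems.MzvKernelInKZ.Negative.Duality
import Literature.Barriers.KontsevichZagierPeriods.AlgebraicPrimitivesObstruction
import Literature.NumberTheory.Transcendental.KZUnfolding

/-!
# Crux `LiouvilleUnfolding.LogPrimitiveNL` (stmt-KontsevichZagierPeriods-2836): one instance, no move in place, four moves across

Negative-side (cdisprove) support: a CALIBRATION of the crux on the datum
`n = 0`, `k = 2`, band `[0, 1]`, `V = (1 + t, 2 − t)`, `V' = (1, −1)`, `h = (1, 1)`: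
`r = affRep = [[0,1], 1/(1+t) − 1/(2−t)]`, `r' = [pt, (log 2 − log 1) + (log 1 − log 2)] = [pt, 0]`.

* `no_semialgebraic_primitive_affRep`: the integrand has NO `ℚ`-semialgebraic primitive on `[0, 1]`
  (simple pole at `t = 2` with residue `≠ 0`; the descent of
  `Literature.Barriers.KontsevichZagierPeriods.KZ.NoSemialgPrimKernel`), so the datum is not ONE
  Newton–Leibniz move (cf. `not_singleMove`);
* `affRep_sub_ptRep_mem_relations`: nevertheless `[r] − [r'] ∈ KZ.relations`, by an explicit chain
  of FOUR move instances: integrand additivity `[r] = [[0,1], 1/(1+t)] + [[0,1], −1/(2−t)]`, the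
  reflection `t ↦ 1 − t` (ONE change of variables, `|det| = 1`, reusing `MzvKernelInKZ.Negative.dualMap`)
  `[[0,1], 1/(1+t)] ~ [[0,1], 1/(2−u)]`, free cancellation `[σ, f] + [σ, −f]`
  (`KZ.of_add_of_neg_mem_levelRel`) and `[pt, 0] ∈ relations` (`KZ.of_mem_levelRel_of_eqOn_zero`).
So the crux HOLDS on this instance, and its certificate necessarily uses rule 2) — the smallest model
of what the route's unfolding must achieve in general.
-/

noncomputable section

open Set MeasureTheory
open Literature.NumberTheory.Transcendental

namespace Summit.KontsevichZagierPeriods.LiouvilleUnfolding.LogPrimitiveNL.Negative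

open Summit.KontsevichZagierPeriods.MzvKernelInKZ.Negative (dualMap dualLin dualMap_apply
  dualMap_dualMap hasFDerivAt_dualMap abs_det_dualLin)

/-! ## The instance -/

/-- `[[0, 1], 1/(1+t)]`. -/
def repA : KZ.IntegralRep 1 :=
  bandRep 0 1 isSemialgebraic_band1_zero_one (fun z => 1 / (1 + z 0))
    ((isSemialgebraicFunOn_aeval_div_aeval isSemialgebraic_band1_zero_one (MvPolynomial.C 1)
        (1 + MvPolynomial.X 0) fun z hz => by
          have h := (mem_band1.1 hz).1
          simp only [map_add, map_one, MvPolynomial.aeval_X]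
          intro h0; linarith).congr
      fun z _ => by simp)
    (continuousOn_const.div (continuousOn_const.add (continuous_apply 0).continuousOn)
      fun z hz => by have h := (mem_band1.1 hz).1; intro h0; linarith)

/-- `[[0, 1], 1/(2−t)]`. -/
def repB : KZ.IntegralRep 1 :=
  bandRep 0 1 isSemialgebraic_band1_zero_one (fun z => 1 / (2 - z 0))
    ((isSemialgebraicFunOn_aeval_div_aeval isSemialgebraic_band1_zero_one (MvPolynomial.C 1)
        (2 - MvPolynomial.X 0) fun z hz => by
          have h := (mem_band1.1 hz).2
          simp only [map_sub, map_ofNat, MvPolynomial.aeval_X]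
          intro h0; linarith).congr
      fun z _ => by simp)
    (continuousOn_const.div (continuousOn_const.sub (continuous_apply 0).continuousOn)
      fun z hz => by have h := (mem_band1.1 hz).2; intro h0; linarith)

/-- `affRep = [[0, 1], 1/(1+t) − 1/(2−t)]`, the band side of the calibration datum. -/
def affRep : KZ.IntegralRep 1 :=
  bandRep 0 1 isSemialgebraic_band1_zero_one (fun z => 1 / (1 + z 0) - 1 / (2 - z 0))
    ((isSemialgebraicFunOn_aeval_div_aeval isSemialgebraic_band1_zero_one
        ((2 - MvPolynomial.X 0) - (1 + MvPolynomial.X 0))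
        ((1 + MvPolynomial.X 0) * (2 - MvPolynomial.X 0)) fun z hz => by
          have h0 := (mem_band1.1 hz).1
          have h1 := (mem_band1.1 hz).2
          simp only [map_mul, map_add, map_sub, map_one, map_ofNat, MvPolynomial.aeval_X]
          apply mul_ne_zero <;> intro h <;> linarith).congr
      fun z hz => by
        have h0 := (mem_band1.1 hz).1
        have h1 := (mem_band1.1 hz).2
        have h2 : (1 : ℝ) + z 0 ≠ 0 := by intro h; linarith
        have h3 : (2 : ℝ) - z 0 ≠ 0 := by intro h; linarith
        simp only [map_mul, map_add, map_sub, map_one, map_ofNat, MvPolynomial.aeval_X]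
        rw [div_sub_div _ _ h2 h3]
        ring)
    (by
      have hA : ContinuousOn (fun z : Fin 1 → ℝ => 1 / (1 + z 0)) (band1 0 1) :=
        continuousOn_const.div (continuousOn_const.add (continuous_apply 0).continuousOn)
          fun z hz => by have h := (mem_band1.1 hz).1; intro h0; linarith
      have hB : ContinuousOn (fun z : Fin 1 → ℝ => 1 / (2 - z 0)) (band1 0 1) :=
        continuousOn_const.div (continuousOn_const.sub (continuous_apply 0).continuousOn)
          fun z hz => by have h := (mem_band1.1 hz).2; intro h0; linarith
      exact hA.sub hB)

/-- The datum satisfies the hypotheses of the crux; stated as: every consequence one draws from the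
crux for it is available — here packaged as the crux's conclusion for this datum following from the
crux (used only as documentation of admissibility; the conclusion is proved outright below). -/
theorem affRep_sub_ptRep_mem_of_crux
    (hc : Summit.KontsevichZagierPeriods.KontsevichZagierPeriods.Theses.LiouvilleUnfolding.LogPrimitiveNL) :
    KZ.of affRep - KZ.of (ptRep 0) ∈ KZ.relations := by
  have hu := Literature.ModelTheory.ExponentialFields.isSemialgebraic_univ (k := ℚ) (R := ℝ)
    (ι := Fin 0)
  refine hc 0 2 affRep (ptRep 0) (fun _ => 0) (fun _ => 1) ![fun _ => 1, fun _ => 1]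
    ![fun z => 1 + z 0, fun z => 2 - z 0] ![fun _ => 1, fun _ => -1]
    ((isSemialgebraicFunOn_const hu 0).congr fun _ _ => by simp)
    ((isSemialgebraicFunOn_const hu 1).congr fun _ _ => by simp)
    (fun _ _ => zero_le_one) rfl ?_ ?_ ?_ ?_ ?_ ?_ ?_ ?_
  · refine Fin.forall_fin_two.2 ⟨?_, ?_⟩ <;>
      exact (isSemialgebraicFunOn_const hu 1).congr fun _ _ => by simp
  · refine Fin.forall_fin_two.2 ⟨?_, ?_⟩
    · show IsSemialgebraicFunOn ℚ (band1 0 1) (fun z : Fin 1 → ℝ => 1 + z 0)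
      exact (isSemialgebraicFunOn_aeval isSemialgebraic_band1_zero_one
        (1 + MvPolynomial.X 0 : MvPolynomial (Fin 1) ℚ)).congr fun z _ => by simp
    · show IsSemialgebraicFunOn ℚ (band1 0 1) (fun z : Fin 1 → ℝ => 2 - z 0)
      exact (isSemialgebraicFunOn_aeval isSemialgebraic_band1_zero_one
        (2 - MvPolynomial.X 0 : MvPolynomial (Fin 1) ℚ)).congr fun z _ => by simp
  · refine Fin.forall_fin_two.2 ⟨fun z hz => ?_, fun z hz => ?_⟩
    · have h0 := (mem_band1.1 hz).1
      show (0 : ℝ) < 1 + z 0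
      linarith
    · have h1 := (mem_band1.1 hz).2
      show (0 : ℝ) < 2 - z 0
      linarith
  · refine Fin.forall_fin_two.2 ⟨fun x _ => ?_, fun x _ => ?_⟩
    · show ContinuousOn (fun t : ℝ => 1 + (Fin.snoc x t : Fin 1 → ℝ) 0) (Icc 0 1)
      simp only [snoc_fin_one_apply_zero]
      exact continuousOn_const.add continuousOn_id
    · show ContinuousOn (fun t : ℝ => 2 - (Fin.snoc x t : Fin 1 → ℝ) 0) (Icc 0 1)
      simp only [snoc_fin_one_apply_zero]
      exact continuousOn_const.sub continuousOn_id
  · refine Fin.forall_fin_two.2 ⟨fun x _ t _ => ?_, fun x _ t _ => ?_⟩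
    · show HasDerivAt (fun s : ℝ => 1 + (Fin.snoc x s : Fin 1 → ℝ) 0) 1 t
      simp only [snoc_fin_one_apply_zero]
      exact (hasDerivAt_id' t).const_add (1 : ℝ)
    · show HasDerivAt (fun s : ℝ => 2 - (Fin.snoc x s : Fin 1 → ℝ) 0) (-1) t
      simp only [snoc_fin_one_apply_zero]
      exact (hasDerivAt_id' t).const_sub (2 : ℝ)
  · refine Fin.forall_fin_two.2 ⟨?_, ?_⟩
    · have hc' : ContinuousOn (fun z : Fin 1 → ℝ => (1 : ℝ) * 1 / (1 + z 0)) (band1 0 1) :=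
        continuousOn_const.div (continuousOn_const.add (continuous_apply 0).continuousOn)
          fun z hz => by have h := (mem_band1.1 hz).1; intro h0; linarith
      show IntegrableOn (fun z : Fin 1 → ℝ => (1 : ℝ) * 1 / (1 + z 0)) (band1 0 1)
      exact hc'.integrableOn_compact (isCompact_band1 0 1)
    · have hc' : ContinuousOn (fun z : Fin 1 → ℝ => (1 : ℝ) * (-1) / (2 - z 0)) (band1 0 1) :=
        continuousOn_const.div (continuousOn_const.sub (continuous_apply 0).continuousOn)
          fun z hz => by have h := (mem_band1.1 hz).2; intro h0; linarith
      show IntegrableOn (fun z : Fin 1 → ℝ => (1 : ℝ) * (-1) / (2 - z 0)) (band1 0 1)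
      exact hc'.integrableOn_compact (isCompact_band1 0 1)
  · intro x _ t ht
    simp only [mem_Ioo] at ht
    have h2 : (1 : ℝ) + t ≠ 0 := by intro h; linarith
    have h3 : (2 : ℝ) - t ≠ 0 := by intro h; linarith
    simp only [affRep, integrand_bandRep, snoc_fin_one_apply_zero, Fin.sum_univ_two,
      Matrix.cons_val_zero, Matrix.cons_val_one]
    field_simp
    ring
  · intro x _
    norm_num [Fin.sum_univ_two]

/-! ## No move in place: the integrand has no semialgebraic primitive -/

open Polynomial in
/-- **No `ℚ`-semialgebraic primitive of `1/(1+t) − 1/(2−t)` on `[0, 1]`** (simple pole at `t = 2`,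
residue `−1 ≠ 0`: `(X − 2)(X + 1) · g' = 2X − 1`, `(2X − 1)(2) = 3 ≠ 0`; descent of
`NoSemialgPrimKernel.eq_zero_of_evalEval_eq_zero`). Hence the calibration datum is not a single
Newton–Leibniz move. -/
theorem no_semialgebraic_primitive_affRep :
    ¬ ∃ F : (Fin 1 → ℝ) → ℝ, IsSemialgebraicFunOn ℚ {x | x 0 ∈ Icc (0 : ℝ) 1} F ∧
      ∀ t ∈ Ioo (0 : ℝ) 1, HasDerivAt (fun s : ℝ => F (fun _ => s)) (1 / (1 + t) - 1 / (2 - t)) t := by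
  rintro ⟨F, hF, hderiv⟩
  obtain ⟨P, hP0, hPv⟩ :=
    Literature.Barriers.KontsevichZagierPeriods.KZ.NoSemialgPrimKernel.exists_ne_zero_evalEval_eq_zero hF
  have hV : (X + C (1 : ℝ) : ℝ[X]).eval 2 ≠ 0 := by norm_num
  have hN : (C (2 : ℝ) * X - C 1 : ℝ[X]).eval 2 ≠ 0 := by norm_num
  have hDN : ∀ t ∈ Ioo (0 : ℝ) 1,
      ((X - C (2 : ℝ)) * (X + C 1)).eval t * (1 / (1 + t) - 1 / (2 - t))
        = (C (2 : ℝ) * X - C 1 : ℝ[X]).eval t := by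
    intro t ht
    have h2 : (1 : ℝ) + t ≠ 0 := by have := ht.1; intro h; linarith
    have h3 : (2 : ℝ) - t ≠ 0 := by have := ht.2; intro h; linarith
    simp only [eval_mul, eval_add, eval_sub, eval_X, eval_C]
    field_simp
    ring
  exact hP0 (Literature.Barriers.KontsevichZagierPeriods.KZ.NoSemialgPrimKernel.eq_zero_of_evalEval_eq_zero
    (G := fun s : ℝ => F fun _ => s) hderiv hDN hV hN P.natDegree P le_rfl
    (fun t ht => hPv t (Ioo_subset_Icc_self ht)))

/-! ## Four moves across -/

/-- In dimension `1` the reflection reads `(dualMap 1 x)₀ = 1 − x₀`. -/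
theorem dualMap_one_apply_zero (x : Fin 1 → ℝ) : dualMap 1 x 0 = 1 - x 0 := by
  rw [dualMap_apply]
  rfl

/-- The reflection `t ↦ 1 − t` maps `[0, 1]` into itself. -/
theorem dualMap_mem_band1 {x : Fin 1 → ℝ} (hx : x ∈ band1 (0 : ℝ) 1) :
    dualMap 1 x ∈ band1 (0 : ℝ) 1 := by
  have h := mem_band1.1 hx
  rw [mem_band1, dualMap_one_apply_zero]
  constructor <;> linarith [h.1, h.2]

/-- The reflection maps `[0, 1]` onto itself. -/
theorem image_dualMap_band1 : dualMap 1 '' band1 (0 : ℝ) 1 = band1 (0 : ℝ) 1 := by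
  apply Subset.antisymm
  · rintro _ ⟨x, hx, rfl⟩
    exact dualMap_mem_band1 hx
  · intro x hx
    exact ⟨dualMap 1 x, dualMap_mem_band1 hx, dualMap_dualMap x⟩

/-- The reflection is a polynomial map over `ℚ`, hence `ℚ`-semialgebraic on `[0, 1]`. -/
theorem isSemialgebraicMapOn_dualMap_band1 : IsSemialgebraicMapOn ℚ (band1 (0 : ℝ) 1) (dualMap 1) := by
  have h := isSemialgebraicMapOn_aeval isSemialgebraic_band1_zero_one
    (fun j : Fin 1 => (1 - MvPolynomial.X (Fin.rev j) : MvPolynomial (Fin 1) ℚ))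
  refine h.congr fun x _ => ?_
  funext j
  simp [dualMap_apply]

/-- **Move 2 (rule 2).** `[[0,1], 1/(1+t)] − [[0,1], 1/(2−u)] ∈ changeOfVariablesRel` along
`u = 1 − t` (`|det| = 1`). -/
theorem repA_sub_repB_mem_changeOfVariablesRel :
    KZ.of repA - KZ.of repB ∈ KZ.changeOfVariablesRel :=
  ⟨1, repA, repB, dualMap 1, fun _ => dualLin 1, isSemialgebraicMapOn_dualMap_band1,
    fun x _ => (hasFDerivAt_dualMap x).hasFDerivWithinAt,
    fun x _ y _ h => by rw [← dualMap_dualMap x, ← dualMap_dualMap y, h],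
    image_dualMap_band1.symm,
    fun x _ => by
      show 1 / (1 + x 0) = 1 / (2 - dualMap 1 x 0) * |(dualLin 1).det|
      rw [abs_det_dualLin, mul_one, dualMap_one_apply_zero]
      congr 1
      ring,
    rfl⟩

/-- **Move 1 (rule 1b).** `[r] − [[0,1], 1/(1+t)] − [[0,1], −1/(2−t)] ∈ integrandAddRel`. -/
theorem affRep_sub_sub_mem_integrandAddRel :
    KZ.of affRep - KZ.of repA - KZ.of repB.neg ∈ KZ.integrandAddRel :=
  ⟨1, affRep, repA, repB.neg, rfl, rfl, fun x _ => by
    show 1 / (1 + x 0) - 1 / (2 - x 0) = 1 / (1 + x 0) + -(1 / (2 - x 0))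
    ring, rfl⟩

/-- **The crux HOLDS on the calibration datum**: `[affRep] − [pt, 0] ∈ KZ.relations`, by four move
instances (integrand additivity, the reflection `t ↦ 1 − t`, free cancellation `[σ,f] + [σ,−f]`,
and `[pt, 0]`), although no single Newton–Leibniz move does it
(`no_semialgebraic_primitive_affRep`). -/
theorem affRep_sub_ptRep_mem_relations : KZ.of affRep - KZ.of (ptRep 0) ∈ KZ.relations := by
  have h1 : KZ.of affRep - KZ.of repA - KZ.of repB.neg ∈ KZ.relations :=
    KZ.integrandAddRel_subset_relations affRep_sub_sub_mem_integrandAddRel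
  have h2 : KZ.of repA - KZ.of repB ∈ KZ.relations :=
    KZ.changeOfVariablesRel_subset_relations repA_sub_repB_mem_changeOfVariablesRel
  have h3 : KZ.of repB + KZ.of repB.neg ∈ KZ.relations :=
    KZ.levelRel_le_relations (KZ.of_add_of_neg_mem_levelRel repB)
  have h4 : KZ.of (ptRep 0) ∈ KZ.relations :=
    KZ.levelRel_le_relations (KZ.of_mem_levelRel_of_eqOn_zero (ptRep 0) fun x _ => by simp)
  have e : KZ.of affRep - KZ.of (ptRep 0) =
      (KZ.of affRep - KZ.of repA - KZ.of repB.neg) + (KZ.of repA - KZ.of repB) +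
        (KZ.of repB + KZ.of repB.neg) - KZ.of (ptRep 0) := by
    abel
  rw [e]
  exact KZ.relations.sub_mem (KZ.relations.add_mem (KZ.relations.add_mem h1 h2) h3) h4

end Summit.KontsevichZagierPeriods.LiouvilleUnfolding.LogPrimitiveNL.Negative
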